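import Summits.AnomalousDissipation.AnomalousDissipation.Theorems.SawtoothPulseCascadeK1LocalisedCascadeWindowBlockV
import Summits.AnomalousDissipation.AnomalousDissipation.Theorems.SawtoothPulseCascadeK1LocalisedCascadeStripStepV

/-!
# K1loc, line `Spectral` / thin start — helper: A GENERAL SPECTRAL CLASS THROUGH A V HALF-STEP OF THE INVISCID CASCADE

Helper file of the prover lane on the crux `K1LocalisedCascade` (stmt-AnomalousDissipation-19491), route
`SawtoothPulseCascade` (S-D fibre ledger; memo v11 §13).  `…StripStepV` treats the strip; the other classes of the ledger
(off-cone `O′`, shell-type `A`, and on the H side the shallow `b`-classes) are windows whose top grows with the fibre.  This file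
wraps `…WindowBlockV.sum_windowBlock_vstep_le` for the ACTUAL iterates `a_{j+1} = b_j ∘ Φ_V` (casts, `|b_j| ≤ 1`, smoothness) and
adds the generic far-tail split, so that each remaining V-step inequality of the ledger is an instance with arithmetic side
conditions only:
* `tsum_indicator_le_sum_add_far` — `Σ'[q]c ≤ Σ_{k∈W} c + Σ'[R ≤ |k_i|]c` when `q ∧ |k_i| ≤ R ⇒ k ∈ W`;
* `sum_window_iterate_vstep_le` — `Σ_{k∈W}‖𝓕a_{j+1}(k)‖² ≤ (J + √(Σ'[Λ ≤ |k₁| ≤ Λ' ∧ Q₁ < |k₀|]‖𝓕b_j‖²))²`,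
  `J = ((Q₁+Q₂)/(Q₂−Q₁))(ε₀ + A√(2N_j·4d₀))`, for `W` finite with `|k₀| + Q₂ ≤ p(k₁) < |k₁|γ`, `Λ ≤ |k₁| ≤ Λ'`;
* `tsum_class_vstep_le` — the same for a class `Σ'[q]‖𝓕a_{j+1}‖²` with `{q} ∩ {|k₁| ≤ Λ'} ⊆ W`, plus the far tail `((1+γ)^{2(j+1)}/Λ')²`.
No definitions; no statement about the crux. [cite: Grafakos2014, Prop. 3.1.2 (5), Prop. 3.2.7 (3), §3.1.3]
[cite: ElgindiLissMattingly2025, §1 (slope ±1 branches)] [problem: turb]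
-/

-- `Summit.<Summit>.<Problem>`: single-conjunct summit, the duplicate namespace segment is deliberate.
set_option linter.dupNamespace false

noncomputable section

namespace Summit.AnomalousDissipation.AnomalousDissipation.Theorems.SawtoothPulseCascade.K1Window

open MeasureTheory Set Filter Topology UnitAddTorus Function Complex Metric
open scoped Real ENNReal
open Literature.Analysis Literature.Analysis.FunctionSpaces Literature.Analysis.FunctionSpaces.Torus Literature.Analysis.FluidPDE
open Literature.Analysis.FluidPDE.ShearStage
open Literature.Analysis.FluidPDE.SawtoothCascade Literature.Analysis.FluidPDE.SawtoothCascade.CascadeParams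
open Summit.AnomalousDissipation.AnomalousDissipation.Theorems.SawtoothPulseCascade.K1Start
open Summit.AnomalousDissipation.AnomalousDissipation.Theorems.SawtoothPulseCascade.K1Flat
open Summit.AnomalousDissipation.AnomalousDissipation.Theorems.SawtoothPulseCascade.K1Ledger.From

/-! ## §1 The far-tail split of a class -/

/-- **A class is a finite window plus a far tail**: for a nonnegative summable density `c`, a predicate `q`, an axis `i`, a
radius `R` and a finite `W ⊇ {q} ∩ {|k_i| ≤ R}`: `Σ'[q]c ≤ Σ_{k∈W} c + Σ'[R ≤ |k_i|]c`. [folklore] -/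
theorem tsum_indicator_le_sum_add_far {c : (Fin 2 → ℤ) → ℝ} (hc : Summable c) (hc0 : ∀ k, 0 ≤ c k)
    (q : (Fin 2 → ℤ) → Prop) [DecidablePred q] (i : Fin 2) (R : ℕ) (W : Finset (Fin 2 → ℤ))
    (hW : ∀ k, q k → |k i| ≤ (R : ℤ) → k ∈ W) :
    ∑' k : Fin 2 → ℤ, (if q k then (1 : ℝ) else 0) * c k ≤
      ∑ k ∈ W, c k + ∑' k : Fin 2 → ℤ, (if (R : ℝ) ≤ |((k i : ℤ) : ℝ)| then (1 : ℝ) else 0) * c k := by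
  classical
  have hI : ∀ (p : (Fin 2 → ℤ) → Prop) [DecidablePred p], Summable fun k => (if p k then (1 : ℝ) else 0) * c k := by
    intro p _
    refine Summable.of_nonneg_of_le (fun k => mul_nonneg (by split_ifs <;> norm_num) (hc0 k)) (fun k => ?_) hc
    exact mul_le_of_le_one_left (hc0 k) (by split_ifs <;> norm_num)
  have hpt : ∀ k : Fin 2 → ℤ, (if q k then (1 : ℝ) else 0) * c k ≤
      (if k ∈ W then (1 : ℝ) else 0) * c k + (if (R : ℝ) ≤ |((k i : ℤ) : ℝ)| then (1 : ℝ) else 0) * c k := by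
    intro k
    rw [← add_mul]
    refine mul_le_mul_of_nonneg_right ?_ (hc0 k)
    have h1 : (0 : ℝ) ≤ (if k ∈ W then (1 : ℝ) else 0) := by split_ifs <;> norm_num
    have h2 : (0 : ℝ) ≤ (if (R : ℝ) ≤ |((k i : ℤ) : ℝ)| then (1 : ℝ) else 0) := by split_ifs <;> norm_num
    by_cases hq : q k
    · rw [if_pos hq]
      by_cases hR : |k i| ≤ (R : ℤ)
      · rw [if_pos (hW k hq hR)]; linarith
      · push Not at hR
        have : (R : ℝ) ≤ |((k i : ℤ) : ℝ)| := by rw [← Int.cast_abs]; exact_mod_cast hR.le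
        rw [if_pos this]; linarith
    · rw [if_neg hq]; linarith
  refine ((hI _).tsum_le_tsum hpt ((hI _).add (hI _))).trans (le_of_eq ?_)
  rw [(hI _).tsum_add (hI _), tsum_eq_sum (s := W) (fun k hk => by simp [hk])]
  congr 1
  exact Finset.sum_congr rfl fun k hk => by rw [if_pos hk, one_mul]

/-! ## §2 A window of the V half-step of the iterates -/

section Cascade

variable (P : CascadeParams)

/-- **Window of `a_{j+1}` through the V half-step** (`…WindowBlockV` for the iterates; see the file header).
[cite: Grafakos2014, Prop. 3.1.2 (5), Prop. 3.2.7 (3), §3.1.3] -/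
theorem sum_window_iterate_vstep_le {G : ℕ} (hγ : P.γ = G) (hδ₀ : 0 < P.δ₀) (hd : 0 < P.d) (hN₀ : 1 ≤ P.N₀)
    (hρN : 1 ≤ P.ρN) (a b : ℕ → UnitAddTorus (Fin 2) → ℝ) (has : ∀ j, IsSmooth (a j)) (h0 : a 0 = datum)
    (hb : ∀ j, b j = a j ∘ shearMap 0 1 (amp ⟨P.U j, P.U_periodic j, P.contDiff_U (P.δ_pos hδ₀ hd j)⟩ P.γ))
    (hab : ∀ j, a (j + 1) = b j ∘ shearMap 1 0 (amp ⟨P.U j, P.U_periodic j, P.contDiff_U (P.δ_pos hδ₀ hd j)⟩ P.γ))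
    (j : ℕ) {Q₁ Q₂ Λ Λ' : ℕ} (hQ : Q₁ < Q₂) (p : ℤ → ℕ)
    (W : Finset (Fin 2 → ℤ)) (hW : ∀ k ∈ W, (Λ : ℤ) ≤ |k 1| ∧ |k 1| ≤ Λ')
    (hWp : ∀ k ∈ W, |k 0| + Q₂ ≤ (p (k 1) : ℤ)) (hpG : ∀ k ∈ W, p (k 1) < (k 1).natAbs * G)
    {d₀ M ε₀ A τ : ℝ} (hd₀ : 0 < d₀) (hM : 1 ≤ M) (hMδ : M * P.δ j < π / 2) (hMd : M * P.δ j < π * P.N j * d₀)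
    (hA0 : 0 ≤ A) (hA : ∀ k ∈ W, ((p (k 1) : ℝ) + ((k 1).natAbs * G : ℕ)) / ((((k 1).natAbs * G : ℕ) : ℝ) - p (k 1)) ≤ A)
    (hτ : ∀ k ∈ W, π / ((((k 1).natAbs * G : ℕ) : ℝ) - p (k 1)) ≤ τ)
    (hAd : 8 * τ ≤ A * d₀) (hε0 : 0 ≤ ε₀)
    (hε : A * (2 * π * ((Λ' * G : ℕ) : ℝ) * (Real.exp (-(M ^ 2 / 2)) / (2 * P.N j))) ≤ ε₀) :
    ∑ k ∈ W, ‖mFourierCoeff (fun x => (a (j + 1) x : ℂ)) k‖ ^ 2 ≤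
      ((((Q₁ : ℝ) + Q₂) / ((Q₂ : ℝ) - Q₁)) * (ε₀ + A * Real.sqrt ((2 * P.N j : ℕ) * (4 * d₀))) +
        Real.sqrt (∑' k : Fin 2 → ℤ, (if (Λ : ℤ) ≤ |k 1| ∧ |k 1| ≤ Λ' ∧ (Q₁ : ℤ) < |k 0| then (1 : ℝ) else 0) *
          ‖mFourierCoeff (fun x => (b j x : ℂ)) k‖ ^ 2)) ^ 2 := by
  set Ψ : ShearProfile := amp ⟨P.U j, P.U_periodic j, P.contDiff_U (P.δ_pos hδ₀ hd j)⟩ P.γ with hΨ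
  set bC : UnitAddTorus (Fin 2) → ℂ := fun x => (b j x : ℂ) with hbC
  have hbs : IsSmooth (b j) := isSmooth_b P hδ₀ hd a b has hb j
  have hbc : Continuous bC := Complex.continuous_ofReal.comp hbs.continuous
  have hbsum : Summable fun k => ‖mFourierCoeff bC k‖ := summable_norm_mFourierCoeff_ofReal_of_isSmooth hbs
  have hb1 : ∀ x, ‖bC x‖ ≤ 1 := fun x => by
    simp only [hbC, Complex.norm_real, Real.norm_eq_abs]
    exact (abs_iterate_le_one P hδ₀ hd a b h0 hb hab j).2 x
  have haC' : (fun x => (a (j + 1) x : ℂ)) = bC ∘ shearMap 1 0 Ψ := by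
    show (fun x => (a (j + 1) x : ℂ)) = (fun x => (b j x : ℂ)) ∘ shearMap 1 0 Ψ
    rw [hab j]; rfl
  rw [haC']
  exact sum_windowBlock_vstep_le P hγ hδ₀ hd hN₀ hρN j hbc hbsum hb1 hQ p W hW hWp hpG hd₀ hM hMδ hMd hA0 hA hτ hAd hε0 hε

/-- **A class of `a_{j+1}` through the V half-step**: for a predicate `q` with `{q} ∩ {|k₁| ≤ Λ'} ⊆ W` (so `q` forces
`|k₁| ≥ Λ` and the window shape), `Σ'[q]‖𝓕a_{j+1}‖² ≤ (J + √PT)² + ((1+γ)^{2(j+1)}/Λ')²` (see the file header).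
[cite: Grafakos2014, Prop. 3.1.2 (5), Prop. 3.2.7 (3), §3.1.3] -/
theorem tsum_class_vstep_le {G : ℕ} (hγ : P.γ = G) (hδ₀ : 0 < P.δ₀) (hd : 0 < P.d) (hN₀ : 1 ≤ P.N₀)
    (hρN : 1 ≤ P.ρN) (a b : ℕ → UnitAddTorus (Fin 2) → ℝ) (has : ∀ j, IsSmooth (a j)) (h0 : a 0 = datum)
    (hb : ∀ j, b j = a j ∘ shearMap 0 1 (amp ⟨P.U j, P.U_periodic j, P.contDiff_U (P.δ_pos hδ₀ hd j)⟩ P.γ))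
    (hab : ∀ j, a (j + 1) = b j ∘ shearMap 1 0 (amp ⟨P.U j, P.U_periodic j, P.contDiff_U (P.δ_pos hδ₀ hd j)⟩ P.γ))
    (j : ℕ) {Q₁ Q₂ Λ Λ' : ℕ} (hQ : Q₁ < Q₂) (hΛ' : 0 < Λ') (p : ℤ → ℕ)
    (q : (Fin 2 → ℤ) → Prop) [DecidablePred q]
    (W : Finset (Fin 2 → ℤ)) (hqW : ∀ k, q k → |k 1| ≤ (Λ' : ℤ) → k ∈ W)
    (hW : ∀ k ∈ W, (Λ : ℤ) ≤ |k 1| ∧ |k 1| ≤ Λ')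
    (hWp : ∀ k ∈ W, |k 0| + Q₂ ≤ (p (k 1) : ℤ)) (hpG : ∀ k ∈ W, p (k 1) < (k 1).natAbs * G)
    {d₀ M ε₀ A τ : ℝ} (hd₀ : 0 < d₀) (hM : 1 ≤ M) (hMδ : M * P.δ j < π / 2) (hMd : M * P.δ j < π * P.N j * d₀)
    (hA0 : 0 ≤ A) (hA : ∀ k ∈ W, ((p (k 1) : ℝ) + ((k 1).natAbs * G : ℕ)) / ((((k 1).natAbs * G : ℕ) : ℝ) - p (k 1)) ≤ A)
    (hτ : ∀ k ∈ W, π / ((((k 1).natAbs * G : ℕ) : ℝ) - p (k 1)) ≤ τ)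
    (hAd : 8 * τ ≤ A * d₀) (hε0 : 0 ≤ ε₀)
    (hε : A * (2 * π * ((Λ' * G : ℕ) : ℝ) * (Real.exp (-(M ^ 2 / 2)) / (2 * P.N j))) ≤ ε₀) :
    ∑' k : Fin 2 → ℤ, (if q k then (1 : ℝ) else 0) * ‖mFourierCoeff (fun x => (a (j + 1) x : ℂ)) k‖ ^ 2 ≤
      ((((Q₁ : ℝ) + Q₂) / ((Q₂ : ℝ) - Q₁)) * (ε₀ + A * Real.sqrt ((2 * P.N j : ℕ) * (4 * d₀))) +
        Real.sqrt (∑' k : Fin 2 → ℤ, (if (Λ : ℤ) ≤ |k 1| ∧ |k 1| ≤ Λ' ∧ (Q₁ : ℤ) < |k 0| then (1 : ℝ) else 0) *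
          ‖mFourierCoeff (fun x => (b j x : ℂ)) k‖ ^ 2)) ^ 2 +
        ((1 + P.γ) ^ (2 * (j + 1)) / Λ') ^ 2 := by
  have hγ0 : 0 ≤ P.γ := by rw [hγ]; exact Nat.cast_nonneg G
  have hbs : IsSmooth (b j) := isSmooth_b P hδ₀ hd a b has hb j
  have hac : Continuous fun x => (a (j + 1) x : ℂ) := by
    rw [hab j]
    exact Complex.continuous_ofReal.comp (hbs.continuous.comp (continuous_shearMap 1 0 _))
  have hcs : Summable fun k => ‖mFourierCoeff (fun x => (a (j + 1) x : ℂ)) k‖ ^ 2 :=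
    (hasSum_sq_mFourierCoeff_of_continuous hac).summable
  refine (tsum_indicator_le_sum_add_far hcs (fun k => sq_nonneg _) q 1 Λ' W hqW).trans (add_le_add ?_ ?_)
  · exact sum_window_iterate_vstep_le P hγ hδ₀ hd hN₀ hρN a b has h0 hb hab j hQ p W hW hWp hpG hd₀ hM hMδ hMd hA0 hA hτ
      hAd hε0 hε
  · exact tsum_far_iterate_le P hγ0 hδ₀ hd a b has h0 hb hab (j + 1) 1 (R := (Λ' : ℝ)) (by exact_mod_cast hΛ')

end Cascade

end Summit.AnomalousDissipation.AnomalousDissipation.Theorems.SawtoothPulseCascade.K1Window
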